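import Summits.Ventures.LatticeQCDFlow.Scaling.CouplingOverlap

/-!
HONEST FRAMING: exact (Metropolis-corrected) sampling algorithms for lattice gauge theory; figures
of merit are autocorrelation/cost numbers at stated couplings and volumes; no continuum-physics
claim.

# FlowReachLaw — THE REACH OF A BOUNDED-DENSITY PROPOSAL IN COUPLING SPACE: IF A MODEL DENSITY IS AT MOST
# `C` TIMES THE WILSON DENSITY AT COUPLING `a`, ITS INDEPENDENCE-METROPOLIS ACCEPTANCE AGAINST THE WILSON
# MEASURE AT COUPLING `b` IS `≤ C·exp(2ψ((a+b)/2) − ψ(a) − ψ(b)) ≤ C·exp(−m(b−a)²/4)` — EVERY COMPACT GAUGE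
# GROUP; THE REACH IS `|b − a| = O(√(log C / volume))` (lean-2 GEN-11, ours)

Venture-side (OURS).  Cell `lqcd-flow` (pub-lqcd), unit `pub-lqcd-lean-2-g11`, 2026-08-23.  Generalises
`Scaling/FlowAcceptanceCeiling` (the case `a = 0`: model density bounded by `C` times the Haar PRIOR) to a
model anchored at ANY member of the family: flows trained at / transported from coupling `a` (coupling-transfer
proposals, flows between nearby couplings) whose push-forward density is `≤ C·p_a`.  Abstract setting of
`SwapAcceptanceLaw`: `μ` probability, `X` bounded measurable, `p_u = e^{uX}/mgf(u)`, `ψ = cgf X μ`.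

* §1 **`imhAcc_le_mul_exp_of_le_member`**: `0 ≤ g ≤ C·p_a` measurable ⇒
  `∫∫ min(p_b(x)g(y), p_b(y)g(x)) dμ dμ ≤ C·exp(2ψ((a+b)/2) − ψ(a) − ψ(b))` (`min ≤ √·√`, `√g ≤ √C·√p_a`, and
  the EXACT Bhattacharyya coefficient `∫√(p_a p_b) = e^{ψ(m) − (ψ(a)+ψ(b))/2}` of `CouplingOverlap`); under a
  variance floor `m` on `[min a b, max a b]`: **`≤ C·exp(−m(b−a)²/4)`** (`imhAcc_le_mul_exp_neg_floor_of_le_member`).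
* §2 Wilson, every compact `G` (`p_β = e^{−βS_W}/Z(β)` over `D[U]`): **`wilson_flowReach_le_allCouplings`**
  (unitary `ρ`, `d ≥ 2`, `L ≥ 2`, `a, b ∈ [−B, B]`): `acc ≤ C·exp(−e^{−B·2NK(1+4K)}·⌊L/2⌋^d·Var_Haar(Re tr ρ)·(b−a)²/4)`;
  **`wilson_flowReach_le_sun`** (`SU(n)`, `0 ≤ a, b ≤ b₁`): `acc ≤ C·exp(−c·#plaq·(b−a)²/(4(1+b₁²)))`.
  READING: a proposal whose density is within a factor `C` of the Wilson density at coupling `a` is accepted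
  at coupling `b` with probability `O(1)` only if `(b−a)² ≲ 4·log C/(m)`, `m ∝ volume`: the REACH of a
  bounded-density sampler in coupling space shrinks like `√(log C/volume)` (T4 `VolumeScalingOfTraining`).

Literature grade (cell rule): KNOWN MECHANISM (`acc ≤ BC²`; Bhattacharyya coefficient of an exponential
family), NEW TYPING; nothing cited as a fact.  NOT CLAIMED: anything about a specific architecture or training
procedure; finite-sample acceptance; the continuum.
-/

noncomputable section

open MeasureTheory ProbabilityTheory Real Set
open Literature.MathematicalPhysics.QuantumFieldTheory
open Literature.MathematicalPhysics.QuantumFieldTheory.Luscher2010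
open Summit.Ventures.LatticeQCDFlow.TrivializingMaps
open scoped Matrix Matrix.Norms.Frobenius ContDiff

namespace Summit.Ventures.LatticeQCDFlow.Scaling

/-! ## §1 Abstract reach law -/

section Abstract

variable {Ω : Type*} [MeasurableSpace Ω] {μ : Measure Ω} [IsProbabilityMeasure μ] {X : Ω → ℝ}

/-- **REACH LAW (abstract)**: if the proposal density satisfies `0 ≤ g ≤ C·p_a`, the stationary
independence-Metropolis acceptance against the target `p_b` is at most `C·exp(2ψ((a+b)/2) − ψ(a) − ψ(b))`.
[ours] -/
theorem imhAcc_le_mul_exp_of_le_member (hXm : Measurable X) (hXb : ∃ C, ∀ x, |X x| ≤ C) (a b : ℝ)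
    {g : Ω → ℝ} (hg : Measurable g) {C : ℝ} (hg0 : ∀ x, 0 ≤ g x)
    (hgC : ∀ x, g x ≤ C * (exp (a * X x) / mgf X μ a)) :
    ∫ z, min (exp (b * X z.1) / mgf X μ b * g z.2) (exp (b * X z.2) / mgf X μ b * g z.1) ∂(μ.prod μ) ≤
      C * exp (2 * cgf X μ ((a + b) / 2) - cgf X μ a - cgf X μ b) := by
  obtain ⟨B, hB⟩ := hXb
  have hXb : ∃ C, ∀ x, |X x| ≤ C := ⟨B, hB⟩
  have hZ : ∀ u, 0 < mgf X μ u := fun u => mgf_pos_of_bounded hXm hXb u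
  set p : ℝ → Ω → ℝ := fun u x => exp (u * X x) / mgf X μ u with hp
  have hp0 : ∀ u x, 0 ≤ p u x := fun u x => div_nonneg (exp_pos _).le (hZ u).le
  have hppos : ∀ u x, 0 < p u x := fun u x => div_pos (exp_pos _) (hZ u)
  have hpm : ∀ u, Measurable (p u) := fun u => ((measurable_const.mul hXm).exp).div_const _
  have hpb : ∀ u x, p u x ≤ exp (|u| * B) / mgf X μ u := fun u x => by
    refine div_le_div_of_nonneg_right (exp_le_exp.2 ?_) (hZ u).le
    calc u * X x ≤ |u * X x| := le_abs_self _
      _ = |u| * |X x| := abs_mul _ _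
      _ ≤ |u| * B := mul_le_mul_of_nonneg_left (hB x) (abs_nonneg _)
  rcases isEmpty_or_nonempty Ω with hΩ | hΩ
  · exact absurd (Measure.eq_zero_of_isEmpty μ) (IsProbabilityMeasure.ne_zero μ)
  have hC : 0 ≤ C := by
    have x₀ := Classical.arbitrary Ω
    have h1 := (hg0 x₀).trans (hgC x₀)
    exact nonneg_of_mul_nonneg_left h1 (hppos a x₀)
  -- `r = √(p_b g)`, bounded measurable
  set r : Ω → ℝ := fun x => sqrt (p b x * g x) with hr
  have hgb : ∀ x, g x ≤ C * (exp (|a| * B) / mgf X μ a) := fun x =>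
    (hgC x).trans (mul_le_mul_of_nonneg_left (hpb a x) hC)
  have hrm : Measurable r := ((hpm b).mul hg).sqrt
  have hrb : ∀ x, |r x| ≤ sqrt (exp (|b| * B) / mgf X μ b * (C * (exp (|a| * B) / mgf X μ a))) := fun x => by
    rw [abs_of_nonneg (sqrt_nonneg _)]
    exact sqrt_le_sqrt (mul_le_mul (hpb b x) (hgb x) (hg0 x) (div_nonneg (exp_pos _).le (hZ b).le))
  have hri : Integrable r μ := integrable_of_abs_le hrm hrb
  have hle : ∫ z, min (p b z.1 * g z.2) (p b z.2 * g z.1) ∂(μ.prod μ) ≤ ∫ z, r z.1 * r z.2 ∂(μ.prod μ) := by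
    refine integral_mono_of_nonneg
      (ae_of_all _ fun z => le_min (mul_nonneg (hp0 b _) (hg0 _)) (mul_nonneg (hp0 b _) (hg0 _)))
      (hri.mul_prod hri) (ae_of_all _ fun z => ?_)
    exact min_mul_le_sqrt_mul_sqrt (hp0 b _) (hg0 _) (hp0 b _) (hg0 _)
  refine hle.trans ?_
  rw [integral_prod_mul]
  -- `∫ r ≤ √C · ∫ √(p_a p_b) = √C · exp(ψ(m) − (ψ(a)+ψ(b))/2)`
  have hsi : Integrable (fun x => sqrt (p a x * p b x)) μ := by
    refine integrable_of_abs_le ((hpm a).mul (hpm b)).sqrt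
      (C := sqrt (exp (|a| * B) / mgf X μ a * (exp (|b| * B) / mgf X μ b))) fun x => ?_
    rw [abs_of_nonneg (sqrt_nonneg _)]
    exact sqrt_le_sqrt (mul_le_mul (hpb a x) (hpb b x) (hp0 b x) (div_nonneg (exp_pos _).le (hZ a).le))
  have hr_le : ∫ x, r x ∂μ ≤ sqrt C * ∫ x, sqrt (p a x * p b x) ∂μ := by
    rw [← integral_const_mul]
    refine integral_mono hri (hsi.const_mul _) fun x => ?_
    show sqrt (p b x * g x) ≤ sqrt C * sqrt (p a x * p b x)
    rw [← sqrt_mul hC]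
    refine sqrt_le_sqrt ?_
    calc p b x * g x ≤ p b x * (C * p a x) := mul_le_mul_of_nonneg_left (hgC x) (hp0 b x)
      _ = C * (p a x * p b x) := by ring
  have hr0 : 0 ≤ ∫ x, r x ∂μ := integral_nonneg fun x => sqrt_nonneg _
  have hsp : ∫ x, sqrt (p a x * p b x) ∂μ = exp (cgf X μ ((a + b) / 2) - (cgf X μ a + cgf X μ b) / 2) :=
    integral_sqrt_tiltedDensity_mul hXm hXb a b
  calc (∫ x, r x ∂μ) * ∫ x, r x ∂μ
      ≤ (sqrt C * ∫ x, sqrt (p a x * p b x) ∂μ) * (sqrt C * ∫ x, sqrt (p a x * p b x) ∂μ) :=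
        mul_le_mul hr_le hr_le hr0 (hr0.trans hr_le)
    _ = C * (∫ x, sqrt (p a x * p b x) ∂μ) ^ 2 := by
        rw [show (sqrt C * ∫ x, sqrt (p a x * p b x) ∂μ) * (sqrt C * ∫ x, sqrt (p a x * p b x) ∂μ) =
          (sqrt C * sqrt C) * (∫ x, sqrt (p a x * p b x) ∂μ) ^ 2 by ring, mul_self_sqrt hC]
    _ = C * exp (2 * cgf X μ ((a + b) / 2) - cgf X μ a - cgf X μ b) := by
        rw [hsp, ← exp_nat_mul]
        congr 2
        push_cast
        ring

/-- **REACH LAW UNDER A VARIANCE FLOOR** (`a ≤ b`, `m ≤ Var_{μ_u}(X)` on `[a,b]`, `0 ≤ g ≤ C·p_a`): the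
acceptance against `p_b` is `≤ C·exp(−m(b−a)²/4)`. [ours] -/
theorem imhAcc_le_mul_exp_neg_floor_of_le_member (hXm : Measurable X) (hXb : ∃ C, ∀ x, |X x| ≤ C)
    {a b m : ℝ} (hab : a ≤ b) (hm : ∀ u ∈ Icc a b, m ≤ variance X (μ.tilted fun x => u * X x))
    {g : Ω → ℝ} (hg : Measurable g) {C : ℝ} (hg0 : ∀ x, 0 ≤ g x)
    (hgC : ∀ x, g x ≤ C * (exp (a * X x) / mgf X μ a)) :
    ∫ z, min (exp (b * X z.1) / mgf X μ b * g z.2) (exp (b * X z.2) / mgf X μ b * g z.1) ∂(μ.prod μ) ≤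
      C * exp (-(m * (b - a) ^ 2 / 4)) := by
  rcases isEmpty_or_nonempty Ω with hΩ | hΩ
  · exact absurd (Measure.eq_zero_of_isEmpty μ) (IsProbabilityMeasure.ne_zero μ)
  have hC : 0 ≤ C := by
    have x₀ := Classical.arbitrary Ω
    exact nonneg_of_mul_nonneg_left ((hg0 x₀).trans (hgC x₀))
      (div_pos (exp_pos _) (mgf_pos_of_bounded hXm hXb a))
  refine (imhAcc_le_mul_exp_of_le_member hXm hXb a b hg hg0 hgC).trans
    (mul_le_mul_of_nonneg_left (exp_le_exp.2 ?_) hC)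
  have h := midpoint_gap_ge_of_deriv2_ge (hasDerivAt_cgf_of_bounded (μ := μ) hXm hXb)
    (hasDerivAt_deriv_cgf_of_bounded (μ := μ) hXm hXb) hab hm
  linarith

/-- The same with the anchor above the target (`b ≤ a`, floor on `[b,a]`). [ours] -/
theorem imhAcc_le_mul_exp_neg_floor_of_le_member' (hXm : Measurable X) (hXb : ∃ C, ∀ x, |X x| ≤ C)
    {a b m : ℝ} (hba : b ≤ a) (hm : ∀ u ∈ Icc b a, m ≤ variance X (μ.tilted fun x => u * X x))
    {g : Ω → ℝ} (hg : Measurable g) {C : ℝ} (hg0 : ∀ x, 0 ≤ g x)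
    (hgC : ∀ x, g x ≤ C * (exp (a * X x) / mgf X μ a)) :
    ∫ z, min (exp (b * X z.1) / mgf X μ b * g z.2) (exp (b * X z.2) / mgf X μ b * g z.1) ∂(μ.prod μ) ≤
      C * exp (-(m * (b - a) ^ 2 / 4)) := by
  rcases isEmpty_or_nonempty Ω with hΩ | hΩ
  · exact absurd (Measure.eq_zero_of_isEmpty μ) (IsProbabilityMeasure.ne_zero μ)
  have hC : 0 ≤ C := by
    have x₀ := Classical.arbitrary Ω
    exact nonneg_of_mul_nonneg_left ((hg0 x₀).trans (hgC x₀))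
      (div_pos (exp_pos _) (mgf_pos_of_bounded hXm hXb a))
  refine (imhAcc_le_mul_exp_of_le_member hXm hXb a b hg hg0 hgC).trans
    (mul_le_mul_of_nonneg_left (exp_le_exp.2 ?_) hC)
  have h := midpoint_gap_ge_of_deriv2_ge (hasDerivAt_cgf_of_bounded (μ := μ) hXm hXb)
    (hasDerivAt_deriv_cgf_of_bounded (μ := μ) hXm hXb) hba hm
  have h2 : (b + a) / 2 = (a + b) / 2 := by ring
  rw [h2] at h
  have h3 : (a - b) ^ 2 = (b - a) ^ 2 := by ring
  rw [h3] at h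
  linarith

end Abstract

/-! ## §2 The Wilson target, every compact gauge group -/

section Wilson

variable {d L N : ℕ} [NeZero L] {G : Type*} [Group G] [TopologicalSpace G] [IsTopologicalGroup G]
  [CompactSpace G] [MeasurableSpace G] [BorelSpace G] [SecondCountableTopology G]
  (ρ : G →* Matrix (Fin N) (Fin N) ℂ)

/-- **REACH LAW UNDER A SPECIFIC-HEAT FLOOR (Wilson)**: `a ≤ b`, `m ≤ Var_u(S_W)` on `[a,b]`, model density
`0 ≤ g ≤ C·p_a` over `D[U]` ⇒ acceptance against `μ_b` `≤ C·exp(−m(b−a)²/4)`. [ours] -/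
theorem wilson_flowReach_le_of_floor (hρ : Continuous ρ) {a b m : ℝ} (hab : a ≤ b)
    (hm : ∀ u ∈ Icc a b, m ≤ variance (wilsonAction (d := d) (L := L) ρ) (wilsonMeasure (d := d) (L := L) ρ u))
    {g : GaugeConfig d L G → ℝ} (hg : Measurable g) {C : ℝ} (hg0 : ∀ U, 0 ≤ g U)
    (hgC : ∀ U, g U ≤ C * (exp (a * (-wilsonAction ρ U)) /
      mgf (fun U => -wilsonAction ρ U) (trivialMeasure G d L) a)) :
    ∫ z, min (exp (b * (-wilsonAction ρ z.1)) /
          mgf (fun U => -wilsonAction ρ U) (trivialMeasure G d L) b * g z.2)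
        (exp (b * (-wilsonAction ρ z.2)) /
          mgf (fun U => -wilsonAction ρ U) (trivialMeasure G d L) b * g z.1)
        ∂((trivialMeasure G d L).prod (trivialMeasure G d L)) ≤
      C * exp (-(m * (b - a) ^ 2 / 4)) := by
  haveI : IsProbabilityMeasure (trivialMeasure G d L) := trivialMeasure_isProbabilityMeasure
  refine imhAcc_le_mul_exp_neg_floor_of_le_member (μ := trivialMeasure G d L)
    (measurable_neg_wilsonAction ρ hρ) (neg_wilsonAction_bounded ρ hρ) hab (fun u hu => ?_) hg hg0 hgC
  have h := hm u hu
  rwa [← tilted_neg_wilsonAction_eq ρ hρ u, ← variance_fun_neg] at h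

/-- **REACH LAW AT EVERY COUPLING, EVERY COMPACT GAUGE GROUP** (unitary `ρ`, `d ≥ 2`, `L ≥ 2`,
`−B ≤ a ≤ b ≤ B`, `0 ≤ g ≤ C·p_a`):
`acc ≤ C·exp(−e^{−B·2NK(1+4K)}·⌊L/2⌋^d·Var_Haar(Re tr ρ)·(b−a)²/4)`. [ours] -/
theorem wilson_flowReach_le_allCouplings (hd : 2 ≤ d) (hL : 2 ≤ L) (hρ : Continuous ρ)
    (hρu : ∀ g, ρ g ∈ Matrix.unitaryGroup (Fin N) ℂ) {a b B : ℝ} (ha : -B ≤ a) (hab : a ≤ b) (hb : b ≤ B)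
    {g : GaugeConfig d L G → ℝ} (hg : Measurable g) {C : ℝ} (hg0 : ∀ U, 0 ≤ g U)
    (hgC : ∀ U, g U ≤ C * (exp (a * (-wilsonAction ρ U)) /
      mgf (fun U => -wilsonAction ρ U) (trivialMeasure G d L) a)) :
    ∫ z, min (exp (b * (-wilsonAction ρ z.1)) /
          mgf (fun U => -wilsonAction ρ U) (trivialMeasure G d L) b * g z.2)
        (exp (b * (-wilsonAction ρ z.2)) /
          mgf (fun U => -wilsonAction ρ U) (trivialMeasure G d L) b * g z.1)
        ∂((trivialMeasure G d L).prod (trivialMeasure G d L)) ≤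
      C * exp (-(Real.exp (-(B * (2 * N * ((d + 1) * d ^ 2 : ℕ) * (1 + 4 * ((d + 1) * d ^ 2 : ℕ))))) *
        ((L / 2) ^ d : ℕ) * variance (fun g => (ρ g).trace.re) (haarProbability G) * (b - a) ^ 2 / 4)) := by
  refine wilson_flowReach_le_of_floor (d := d) (L := L) ρ hρ hab (fun u hu => ?_) hg hg0 hgC
  refine le_trans ?_ (wilson_variance_ge_allCouplings (d := d) (L := L) ρ hd hL hρ hρu u)
  have hv : 0 ≤ variance (fun g => (ρ g).trace.re) (haarProbability G) := variance_nonneg _ _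
  have hu' : |u| ≤ B := abs_le.2 ⟨by linarith [hu.1], by linarith [hu.2]⟩
  have hc : 0 ≤ (2 * N * ((d + 1) * d ^ 2 : ℕ) * (1 + 4 * ((d + 1) * d ^ 2 : ℕ)) : ℝ) := by positivity
  gcongr

end Wilson

/-! ## §3 `SU(n)` -/

section SUN

variable {d n : ℕ}

/-- **`SU(n)` REACH LAW** (`n ≥ 2`, `d ≥ 2`): one `c = c(n,d) > 0` such that for every `L ≥ 2`, all
`0 ≤ a ≤ b`, and every measurable model density `0 ≤ g ≤ C·p_a`: acceptance against `μ_b`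
`≤ C·exp(−c·#plaq·(b−a)²/(4(1+b²)))`. [ours] -/
theorem wilson_flowReach_le_sun (hn : 2 ≤ n) (hd : 2 ≤ d) :
    ∃ c : ℝ, 0 < c ∧ ∀ (L : ℕ) [NeZero L], 2 ≤ L → ∀ a b : ℝ, 0 ≤ a → a ≤ b →
      ∀ (g : GaugeConfig d L (Matrix.specialUnitaryGroup (Fin n) ℂ) → ℝ), Measurable g →
        ∀ C : ℝ, (∀ U, 0 ≤ g U) →
          (∀ U, g U ≤ C * (exp (a * (-wilsonAction (StrongCoupling.defRep n) U)) /
            mgf (fun U => -wilsonAction (StrongCoupling.defRep n) U)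
              (trivialMeasure (Matrix.specialUnitaryGroup (Fin n) ℂ) d L) a)) →
          ∫ z, min (exp (b * (-wilsonAction (StrongCoupling.defRep n) z.1)) /
                mgf (fun U => -wilsonAction (StrongCoupling.defRep n) U)
                  (trivialMeasure (Matrix.specialUnitaryGroup (Fin n) ℂ) d L) b * g z.2)
              (exp (b * (-wilsonAction (StrongCoupling.defRep n) z.2)) /
                mgf (fun U => -wilsonAction (StrongCoupling.defRep n) U)
                  (trivialMeasure (Matrix.specialUnitaryGroup (Fin n) ℂ) d L) b * g z.1)
              ∂((trivialMeasure (Matrix.specialUnitaryGroup (Fin n) ℂ) d L).prod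
                (trivialMeasure (Matrix.specialUnitaryGroup (Fin n) ℂ) d L)) ≤
            C * exp (-(c * Fintype.card (Plaquette d L) * (b - a) ^ 2 / (4 * (1 + b ^ 2)))) := by
  obtain ⟨c, hc, h⟩ := wilson_variance_floor_allCouplings_rep (d := d) (n := n) hn hd
  refine ⟨c, hc, fun L _ hL a b ha hab g hg C hg0 hgC => ?_⟩
  have hρ : Continuous (StrongCoupling.defRep n) := continuous_subtype_val
  have h1 := wilson_flowReach_le_of_floor (d := d) (L := L) (StrongCoupling.defRep n) hρ hab
    (m := c * Fintype.card (Plaquette d L) / (1 + b ^ 2)) (fun u hu => ?_) hg hg0 hgC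
  · have hexp : c * Fintype.card (Plaquette d L) / (1 + b ^ 2) * (b - a) ^ 2 / 4 =
        c * Fintype.card (Plaquette d L) * (b - a) ^ 2 / (4 * (1 + b ^ 2)) := by
      rw [div_mul_eq_mul_div, div_div, mul_comm (1 + b ^ 2) 4]
    rw [hexp] at h1
    exact h1
  · have hu0 : 0 ≤ u := ha.trans hu.1
    refine le_trans ?_ (h L hL u hu0)
    have hP : 0 ≤ c * Fintype.card (Plaquette d L) := by positivity
    have hu1 : 1 + u ^ 2 ≤ 1 + b ^ 2 := by nlinarith [hu.1, hu.2]
    exact div_le_div_of_nonneg_left hP (by positivity) hu1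

end SUN

end Summit.Ventures.LatticeQCDFlow.Scaling

end
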